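import Summits.QuantumFields.BalabanUV.T4Continuum.Spine.NE4.AutonomousSchemeLinearized
import Literature.LinearAlgebra.Matrix.ConvergentMatrix

/-!
# Spine/NE4/AutonomousSchemeSpectral — (R45) THE SPECTRAL FORM ON THE AUTONOMOUS ROAD: Gelfand's formula turns a SPECTRAL-RADIUS bound on
# the ONE linearised operator of (R43) into its power hypothesis; the invariant ball is DERIVED from a small source; NE4 at every rate above ρ(T₀)

Cell `pub-balaban-gaps` (YM blitz G2), seat `ne4`, generation 11 (unit `pub-balaban-gaps-ne4-g11`); record `HOME/ne/NE4.md` §5 (R45).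
HONEST FRAMING as in `AutonomousScheme` ∕ `AutonomousSchemeStable` ∕ `AutonomousSchemeLinearized`: hypothesis shapes about an ABSTRACT one-step map on a
normed space + Mathlib spectral theory (Gelfand's formula) + elementary bookkeeping; NE4 (`T4CouplingMatching.ScaleShiftRate`, NOT IN PRINT —
[Balaban1987RG1] = CMP **109** p. 264 «We will investigate other properties in a separate paper») is NOT proved; nothing of Bałaban's is asserted; no
status word of the cell moves (NE4 stays DEPENDENT, spine 0∕9).  One finite T⁴; NOT ℝ⁴, NOT infinite volume, NOT a mass gap, NOT Clay.

THE POINT (eleventh reader).  Generation 10 reduced (R42)(e)'s one hypothesis on Bałaban's k-independent RT — uniform exponential stability along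
admissible orbits — to the triple (S) invariant set + (L) ONE contracting power `‖T₀ ^ N‖ ≤ θ′ ^ N` of ONE bounded linear operator + (N) a Lipschitz
linearization defect `δ` with `Kc·δ < 1 − θ′` (`Markov.orbitStability_of_linearDefect`).  Two of the three inputs are sharpened here:

* §1 (L) IN SPECTRAL FORM.  One level down, `T4SpectralRenewal` §4 records — with a kernel witness, `hazard_not_cocycleBound`: two nilpotent steps of
  spectral radius `0` whose alternating cocycle grows like `4^m` — that on the NON-AUTONOMOUS flag road a spectral-radius hypothesis per step is NOT a
  sufficient form of the memory input.  On the AUTONOMOUS road there is ONE operator, and Gelfand's formula (Mathlib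
  `spectrum.pow_nnnorm_pow_one_div_tendsto_nhds_spectralRadius`, through the tree's `Literature.LinearAlgebra.Matrix.eventually_nnnorm_pow_le_of_spectralRadius_lt`,
  [HornJohnson2013] Cor. 5.6.13–14) turns `spectralRadius ℂ T₀ < θ′` into the power hypothesis: `exists_pow_norm_le_of_spectralRadius_lt`,
  `exists_powerBound_of_spectralRadius_lt`; for the REAL scheme data of (R42)∕(R43) on a complex Banach space the operator enters as `T₀.restrictScalars ℝ`
  (`norm_restrictScalars_pow`, `exists_pow_norm_restrictScalars_le`).  So the lore of census (R32) — «the rate of approach to the renormalized trajectory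
  is the leading irrelevant eigenvalue of the linearised blocking» ([HasenfratzNiedermayer1994] §2.7) — IS an admissible hypothesis SHAPE on this road, and
  norm-independent (the spectral radius ignores an equivalent renorming; `Kc` does not).  The depth `N` is NOT explicit: the spectral form is qualitative.
* §2 (S) DERIVED.  `gaugeBall T₀ θ′ N R = {x | mgauge x ≤ R}` (the ball of (R43)'s module gauge; between the norm balls of radii `R∕Kc` and `R`, convex:
  `closedBall_subset_gaugeBall`, `gaugeBall_subset_closedBall`, `convex_gaugeBall`).  `invariant_gaugeBall`: the power hypothesis, the defect ON THE GAUGE BALL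
  and a SOURCE bound `FirstStep A 0 s γ` — `‖A g 0‖ ≤ s`, the size of what one step generates from the bare state `0` («no irrelevant terms»; for RT the
  printed TYPE of bound, [Balaban1988Convergent] = CMP **119** (2.43) p. 263: sizes of the new terms) — with the balance `Kc·s + (θ′ + Kc·δ)·R ≤ R` make the
  gauge ball INVARIANT (`invariant_gaugeBall_halfGap`: defect ≤ half the gap and `R ≥ 2Kc·s∕(1 − θ′)` suffice) — (S) is OUTPUT once the source is small
  against the gap, as in the template's invariant ball of radius `O(g³)` with `K₀ = 0` ([BauerschmidtBrydgesSlade2019RG] Thm 2.3.1, |φ|⁴; TEMPLATE only).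
* §3 THE CLOSED INPUT LIST OF THE AUTONOMOUS ROAD (power form, explicit constants): `orbitStability_gaugeBall`, `ne4_of_gaugeBall` — bare state `0`,
  `‖T₀ ^ N‖ ≤ θ′ ^ N` [for RT: Gaussian power counting after extraction of the marginal F² coefficient and the constant], defect `δ` on the gauge ball
  [NOT PRINTED — wall (M) of rows NE5 ∕ NE9 in its weakest, local form], source `s` [printed TYPE], coupling-Lipschitz `ℓ` and read-out `cr` on the ball ⟹
  node U2's triple `ScaleShiftRate (cr·Kc·s·ρ) ρ γ β ∧ HistLipschitz Λ γ β ∧ FadingMemory (cr·Kc·ℓ) ρ Λ`, `ρ = θ′ + Kc·δ`; `conv_of_gaugeBall`: the β⁰-half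
  (AF-0r) from the same list (census (R31)).  `Invariant` is no longer a hypothesis.
* §4 THE SPECTRAL FORM (qualitative): `orbitStability_of_spectralRadius` — `spectralRadius ℂ T < θ′ < θ″` ⟹ ∃ `K ≥ 1`, `δ₀ > 0` such that EVERY real
  scheme with an invariant set and defect `≤ δ₀` relative to `T` is orbit-stable at rate `θ″` with constant `K`; faces `scaleShiftRate_of_spectralRadius`,
  `ne4_of_spectralRadius` (NE4 ∕ node U2's triple at every rate above the spectral radius of the linearisation, for all sufficiently small defects).
* §5 EXACTNESS: `spectralRadius_le_of_powerBound` (a power bound at rate `θ` forces `spectralRadius ≤ θ`, any complex Banach algebra — Mathlib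
  `spectrum.spectralRadius_le_pow_nnnorm_pow_one_div` + `ENNReal.eventually_pow_one_div_le`), `powerBound_of_orbitStability_linear`,
  `spectralRadius_le_of_orbitStability_linear`: for the LINEAR scheme `x ↦ T x` (zero defect) orbit stability at rate `θ` forces `ρ(T) ≤ θ`.  With §4 the
  achievable rates on the autonomous road for the linearised scheme are EXACTLY the numbers above `ρ(T₀)` — the kernel form of «NE4's θ is the leading
  irrelevant eigenvalue of the scheme's linearised step», two-sided; census (R44) measured exactly this in the Migdal–Kadanoff caricature (θ_MK = λ⁻⁴ = the
  subleading eigenvalue of the linearised MK recursion; MODEL).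
WHAT THIS SAYS FOR THE ROW (census (R45); classification words UNCHANGED — DEPENDENT; U2 WORK done; upstream WORK-bound LARGE; 0∕9).  On (R42)'s idea road
the input list now reads: {`ρ(T₀) < 1` for the Gaussian linearisation of the k-independent RT after extraction, in ONE k-uniform Banach norm on NODE O's
objects [power counting + symmetry: a GAUSSIAN statement]; a second-order Lipschitz defect of RT − T₀ on a gauge ball [NOT PRINTED]; the one-step source
from the pure Wilson action small against the gap [printed TYPE]; coupling-Lipschitz + read-out Lipschitz [unprinted constants of printed-type objects]} ⟹
NE4, node U2's whole β-side list and (AF-0r), at every rate above `ρ(T₀)`.  The located NON-PRINTED item is unchanged in kind — (N) —; everything else on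
this road is Gaussian or of printed type.  Nothing here is a statement about Bałaban's actual RT: the typing records what such a proof must supply.
-/

namespace Summit.QuantumFields.BalabanUV.T4Continuum.Spine.NE4

open Literature.MathematicalPhysics.QuantumFieldTheory.Balaban1983to89
open Literature.MathematicalPhysics.QuantumFieldTheory.Balaban1983to89.FlowStep
open Literature.MathematicalPhysics.QuantumFieldTheory.Balaban1983to89.T4CouplingMatching
  (ScaleShiftRate HistLipschitz FadingMemory EventualLowerH disc)
open Literature.MathematicalPhysics.QuantumFieldTheory.Balaban1983to89.T4FlagMemory (Adm)
open Literature.MathematicalPhysics.QuantumFieldTheory.Balaban1983to89.T4SpectralRenewal (Kc Kc_nonneg PowerBound)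
open Finset
open scoped ENNReal NNReal

namespace Markov

/-! ## §1 Gelfand: a spectral-radius bound on ONE operator yields one contracting power (complex Banach space) -/

section Gelfand

variable {E : Type*} [NormedAddCommGroup E] [NormedSpace ℂ E] [CompleteSpace E]

/-- **ONE CONTRACTING POWER FROM THE SPECTRAL RADIUS** (Gelfand's formula, via the tree's `Literature.LinearAlgebra.Matrix.eventually_nnnorm_pow_le_of_spectralRadius_lt`,
[HornJohnson2013] Cor. 5.6.13–14): for a bounded operator `T` on a complex Banach space and `θ′ ≥ 0` with `spectralRadius ℂ T < θ′`, there is a depth `N ≥ 1` with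
`‖T ^ N‖ ≤ θ′ ^ N` — the power hypothesis of `T4SpectralRenewal.powerBound_of_pow_le` ∕ `Markov.orbitStability_of_linearDefect`.  The depth is NOT explicit (Gelfand's
formula is a limit statement): the spectral form is qualitative, the power form quantitative. [folklore] -/
theorem exists_pow_norm_le_of_spectralRadius_lt (T : E →L[ℂ] E) {θ' : ℝ} (hθ : 0 ≤ θ')
    (h : spectralRadius ℂ T < ENNReal.ofReal θ') : ∃ N : ℕ, 1 ≤ N ∧ ‖T ^ N‖ ≤ θ' ^ N := by
  obtain ⟨N, hN, hle⟩ := ((Literature.LinearAlgebra.Matrix.eventually_nnnorm_pow_le_of_spectralRadius_lt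
    (show spectralRadius ℂ T < ((θ'.toNNReal : ℝ≥0) : ℝ≥0∞) from h)).and (Filter.eventually_ge_atTop 1)).exists
  refine ⟨N, hle, ?_⟩
  have e : ((‖T ^ N‖₊ : ℝ≥0) : ℝ) ≤ ((θ'.toNNReal ^ N : ℝ≥0) : ℝ) := NNReal.coe_le_coe.mpr hN
  simpa [Real.coe_toNNReal _ hθ] using e

/-- **POWER BOUND FROM THE SPECTRAL RADIUS**: `spectralRadius ℂ T < θ′` ⟹ `PowerBound (Kc T θ′ N) θ′ T` for some depth `N ≥ 1`. [folklore] -/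
theorem exists_powerBound_of_spectralRadius_lt (T : E →L[ℂ] E) {θ' : ℝ} (hθ : 0 < θ')
    (h : spectralRadius ℂ T < ENNReal.ofReal θ') : ∃ N : ℕ, 1 ≤ N ∧ PowerBound (Kc T θ' N) θ' T := by
  obtain ⟨N, hN, hle⟩ := exists_pow_norm_le_of_spectralRadius_lt T hθ.le h; exact ⟨N, hN, T4SpectralRenewal.powerBound_of_pow_le hθ hN hle⟩

omit [CompleteSpace E] in
/-- [bookkeeping] Restricting scalars commutes with powers: `(T.restrictScalars ℝ) ^ N = (T ^ N).restrictScalars ℝ`. [folklore] -/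
theorem restrictScalars_pow (T : E →L[ℂ] E) : ∀ N : ℕ, (T.restrictScalars ℝ) ^ N = (T ^ N).restrictScalars ℝ
  | 0 => by ext x; simp
  | N + 1 => by
    rw [pow_succ, pow_succ, restrictScalars_pow T N]
    ext x
    rfl

omit [CompleteSpace E] in
/-- [bookkeeping] The real restriction has the same power norms: `‖(T.restrictScalars ℝ) ^ N‖ = ‖T ^ N‖`. [folklore] -/
theorem norm_restrictScalars_pow (T : E →L[ℂ] E) (N : ℕ) : ‖(T.restrictScalars ℝ) ^ N‖ = ‖T ^ N‖ := by
  rw [restrictScalars_pow, ContinuousLinearMap.norm_restrictScalars]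

/-- **THE REAL SCHEME's POWER HYPOTHESIS FROM THE COMPLEX SPECTRAL RADIUS**: `spectralRadius ℂ T < θ′` ⟹ some depth `N ≥ 1` has
`‖(T.restrictScalars ℝ) ^ N‖ ≤ θ′ ^ N` — the exact input of (R43)'s `orbitStability_of_linearDefect` for the real-linear scheme data. [folklore] -/
theorem exists_pow_norm_restrictScalars_le (T : E →L[ℂ] E) {θ' : ℝ} (hθ : 0 ≤ θ')
    (h : spectralRadius ℂ T < ENNReal.ofReal θ') : ∃ N : ℕ, 1 ≤ N ∧ ‖(T.restrictScalars ℝ) ^ N‖ ≤ θ' ^ N := by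
  obtain ⟨N, hN, hle⟩ := exists_pow_norm_le_of_spectralRadius_lt T hθ h; exact ⟨N, hN, (norm_restrictScalars_pow T N).le.trans hle⟩

end Gelfand

/-! ## §2 The gauge ball: with the source small against the spectral gap, the invariant set (S) is DERIVED, not assumed -/

section GaugeBall

variable {E : Type*} [NormedAddCommGroup E] [NormedSpace ℝ E]

/-- The GAUGE BALL of radius `R`: `{x | mgauge T₀ θ′ N x ≤ R}` — the closed ball of (R43)'s module gauge (between the norm balls of radii `R∕Kc` and `R`). [folklore] -/
def gaugeBall (T₀ : E →L[ℝ] E) (θ' : ℝ) (N : ℕ) (R : ℝ) : Set E := {x | mgauge T₀ θ' N x ≤ R}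

/-- [bookkeeping] membership in the gauge ball. [folklore] -/
theorem mem_gaugeBall {T₀ : E →L[ℝ] E} {θ' : ℝ} {N : ℕ} {R : ℝ} {x : E} : x ∈ gaugeBall T₀ θ' N R ↔ mgauge T₀ θ' N x ≤ R := Iff.rfl

/-- [bookkeeping] the gauge vanishes at the origin. [folklore] -/
theorem mgauge_zero (T₀ : E →L[ℝ] E) (θ' : ℝ) (N : ℕ) : mgauge T₀ θ' N 0 = 0 := by simp [mgauge]

/-- [bookkeeping] the gauge is absolutely homogeneous: `mgauge (c • x) = |c|·mgauge x`. [folklore] -/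
theorem mgauge_smul (T₀ : E →L[ℝ] E) (θ' : ℝ) (N : ℕ) (c : ℝ) (x : E) :
    mgauge T₀ θ' N (c • x) = |c| * mgauge T₀ θ' N x := by
  unfold mgauge
  rw [Finset.mul_sum]
  refine Finset.sum_congr rfl fun n _ => ?_
  rw [map_smul, norm_smul, Real.norm_eq_abs]; ring

/-- [bookkeeping] the origin (the bare state «no irrelevant terms») lies in every gauge ball of non-negative radius. [folklore] -/
theorem zero_mem_gaugeBall (T₀ : E →L[ℝ] E) (θ' : ℝ) (N : ℕ) {R : ℝ} (hR : 0 ≤ R) : (0 : E) ∈ gaugeBall T₀ θ' N R :=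
  show mgauge T₀ θ' N 0 ≤ R from (mgauge_zero T₀ θ' N).le.trans hR

/-- The gauge ball lies inside the norm ball of the same radius (`‖x‖ ≤ mgauge x`, depth `N ≥ 1`). [folklore] -/
theorem gaugeBall_subset_closedBall (T₀ : E →L[ℝ] E) {θ' : ℝ} (hθ : 0 ≤ θ') {N : ℕ} (hN : 1 ≤ N) (R : ℝ) :
    gaugeBall T₀ θ' N R ⊆ Metric.closedBall (0 : E) R := fun x hx =>
  mem_closedBall_zero_iff.mpr ((norm_le_mgauge T₀ hθ hN x).trans hx)

/-- The norm ball of radius `R ∕ Kc` lies inside the gauge ball of radius `R` (`mgauge x ≤ Kc‖x‖`; with Lean's `R ∕ 0 = 0` the degenerate case `Kc = 0`,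
possible only on the trivial space, is covered too). [folklore] -/
theorem closedBall_subset_gaugeBall (T₀ : E →L[ℝ] E) {θ' : ℝ} (hθ : 0 ≤ θ') (N : ℕ) {R : ℝ} (hR : 0 ≤ R) :
    Metric.closedBall (0 : E) (R / Kc T₀ θ' N) ⊆ gaugeBall T₀ θ' N R := by
  intro x hx
  rw [mem_closedBall_zero_iff] at hx
  rw [mem_gaugeBall]
  rcases (Kc_nonneg T₀ hθ N).eq_or_lt with hK | hK
  · calc mgauge T₀ θ' N x ≤ Kc T₀ θ' N * ‖x‖ := mgauge_le_Kc_mul T₀ hθ N x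
      _ = 0 := by rw [← hK, zero_mul]
      _ ≤ R := hR
  · calc mgauge T₀ θ' N x ≤ Kc T₀ θ' N * ‖x‖ := mgauge_le_Kc_mul T₀ hθ N x
      _ ≤ Kc T₀ θ' N * (R / Kc T₀ θ' N) := mul_le_mul_of_nonneg_left hx hK.le
      _ = R := mul_div_cancel₀ R hK.ne'

/-- The gauge ball is CONVEX (the gauge is subadditive and absolutely homogeneous) — so the derivative currency of (R43) §4 applies on it. [folklore] -/
theorem convex_gaugeBall (T₀ : E →L[ℝ] E) {θ' : ℝ} (hθ : 0 ≤ θ') (N : ℕ) (R : ℝ) : Convex ℝ (gaugeBall T₀ θ' N R) := by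
  intro x hx y hy a b ha hb hab
  rw [mem_gaugeBall] at hx hy ⊢
  calc mgauge T₀ θ' N (a • x + b • y) ≤ mgauge T₀ θ' N (a • x) + mgauge T₀ θ' N (b • y) := mgauge_add_le T₀ hθ N _ _
    _ = a * mgauge T₀ θ' N x + b * mgauge T₀ θ' N y := by rw [mgauge_smul, mgauge_smul, abs_of_nonneg ha, abs_of_nonneg hb]
    _ ≤ a * R + b * R := add_le_add (mul_le_mul_of_nonneg_left hx ha) (mul_le_mul_of_nonneg_left hy hb)
    _ = R := by rw [← add_mul, hab, one_mul]

/-- **THE INVARIANT SET DERIVED.**  `‖T₀ ^ N‖ ≤ θ′ ^ N` (`θ′ > 0`, `N ≥ 1`), the defect `LinearDefect A T₀ (gaugeBall R) δ γ` ON THE GAUGE BALL, and a SOURCE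
bound `FirstStep A 0 s γ` (`‖A g 0‖ ≤ s` at every coupling in ]0,γ]: the size of what one step generates from the bare state `0` — for RT the printed TYPE of
bound, [Balaban1988Convergent] (2.43) p. 263, sizes of the new terms) with `Kc·s + (θ′ + Kc·δ)·R ≤ R` ⟹ `Invariant A (gaugeBall R) γ`.  In words: the ball of
gauge-radius `R ≥ Kc·s ∕ (1 − θ′ − Kc·δ)` is mapped into itself — (S) of the (R43) triple is OUTPUT once the source is small against the spectral gap. [folklore] -/
theorem invariant_gaugeBall {A : ℝ → E → E} {T₀ : E →L[ℝ] E} {θ' δ s γ R : ℝ} {N : ℕ} (hθ : 0 < θ') (hN : 1 ≤ N)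
    (hT : ‖T₀ ^ N‖ ≤ θ' ^ N) (hdef : LinearDefect A T₀ (gaugeBall T₀ θ' N R) δ γ) (hδ : 0 ≤ δ)
    (hsrc : FirstStep A 0 s γ) (hR : 0 ≤ R) (hbal : Kc T₀ θ' N * s + (θ' + Kc T₀ θ' N * δ) * R ≤ R) :
    Invariant A (gaugeBall T₀ θ' N R) γ := by
  intro g hg0 hgγ x hx
  have hK : 0 ≤ Kc T₀ θ' N := Kc_nonneg T₀ hθ.le N
  have h0 : (0 : E) ∈ gaugeBall T₀ θ' N R := zero_mem_gaugeBall T₀ θ' N hR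
  have hs : ‖A g 0‖ ≤ s := by simpa [dist_zero_right] using hsrc g hg0 hgγ
  have hstep := mgauge_step_le hθ hN hT hdef hδ hg0 hgγ hx h0
  rw [sub_zero] at hstep
  rw [mem_gaugeBall] at hx ⊢
  have e : A g x = (A g x - A g 0) + A g 0 := (sub_add_cancel _ _).symm
  calc mgauge T₀ θ' N (A g x) = mgauge T₀ θ' N ((A g x - A g 0) + A g 0) := by rw [← e]
    _ ≤ mgauge T₀ θ' N (A g x - A g 0) + mgauge T₀ θ' N (A g 0) := mgauge_add_le T₀ hθ.le N _ _
    _ ≤ (θ' + Kc T₀ θ' N * δ) * mgauge T₀ θ' N x + Kc T₀ θ' N * ‖A g 0‖ := add_le_add hstep (mgauge_le_Kc_mul T₀ hθ.le N _)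
    _ ≤ (θ' + Kc T₀ θ' N * δ) * R + Kc T₀ θ' N * s :=
        add_le_add (mul_le_mul_of_nonneg_left hx (by positivity)) (mul_le_mul_of_nonneg_left hs hK)
    _ ≤ R := by linarith

/-- **THE INVARIANT BALL UNDER THE HALF-GAP SMALLNESS** (the usable corollary): `Kc·δ ≤ (1 − θ′)∕2` (defect at most half the gap) and
`2·Kc·s ≤ (1 − θ′)·R` (radius at least `2Kc·s∕(1 − θ′)`) ⟹ `Invariant A (gaugeBall R) γ`. [folklore] -/
theorem invariant_gaugeBall_halfGap {A : ℝ → E → E} {T₀ : E →L[ℝ] E} {θ' δ s γ R : ℝ} {N : ℕ} (hθ : 0 < θ') (hN : 1 ≤ N)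
    (hT : ‖T₀ ^ N‖ ≤ θ' ^ N) (hdef : LinearDefect A T₀ (gaugeBall T₀ θ' N R) δ γ) (hδ : 0 ≤ δ)
    (hsrc : FirstStep A 0 s γ) (hR : 0 ≤ R) (hgap : Kc T₀ θ' N * δ ≤ (1 - θ') / 2) (hRs : 2 * Kc T₀ θ' N * s ≤ (1 - θ') * R) :
    Invariant A (gaugeBall T₀ θ' N R) γ := by
  refine invariant_gaugeBall hθ hN hT hdef hδ hsrc hR ?_
  nlinarith [Kc_nonneg T₀ hθ.le N]

end GaugeBall

/-! ## §3 Orbit stability and NE4 on the derived ball: the autonomous road's closed input list (power form, explicit constants) -/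

section Closed

variable {E : Type*} [NormedAddCommGroup E] [NormedSpace ℝ E] {A : ℝ → E → E} {T₀ : E →L[ℝ] E}
  {r : E → ℝ} {β : HBeta} {θ' δ s ℓ γ cr R : ℝ} {N : ℕ}

/-- **ORBIT STABILITY ON THE DERIVED BALL**: power hypothesis + defect on the gauge ball + small source ⟹ the gauge ball is invariant AND the scheme is
uniformly exponentially stable on it at rate `θ′ + Kc·δ` with constant `Kc` (`invariant_gaugeBall` ∘ `orbitStability_of_linearDefect`). [folklore] -/
theorem orbitStability_gaugeBall (hθ : 0 < θ') (hN : 1 ≤ N) (hT : ‖T₀ ^ N‖ ≤ θ' ^ N)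
    (hdef : LinearDefect A T₀ (gaugeBall T₀ θ' N R) δ γ) (hδ : 0 ≤ δ) (hsrc : FirstStep A 0 s γ) (hR : 0 ≤ R)
    (hbal : Kc T₀ θ' N * s + (θ' + Kc T₀ θ' N * δ) * R ≤ R) :
    Invariant A (gaugeBall T₀ θ' N R) γ ∧ OrbitStability A (gaugeBall T₀ θ' N R) (Kc T₀ θ' N) (θ' + Kc T₀ θ' N * δ) γ :=
  have hInv := invariant_gaugeBall hθ hN hT hdef hδ hsrc hR hbal
  ⟨hInv, orbitStability_of_linearDefect hθ hN hT hInv hdef hδ⟩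

/-- **NE4 ∕ NODE U2's β-SIDE TRIPLE FROM THE CLOSED INPUT LIST OF THE AUTONOMOUS ROAD** — bare state `0`, power hypothesis `‖T₀ ^ N‖ ≤ θ′ ^ N` [for RT:
Gaussian power counting after extraction], defect `δ` on the gauge ball [NOT PRINTED], source `s` [printed TYPE] balanced against the gap, coupling-Lipschitz `ℓ` on
the ball, read-out `cr`-Lipschitz on the ball ⟹ `ScaleShiftRate (cr·Kc·s·ρ) ρ γ β ∧ HistLipschitz Λ γ β ∧ FadingMemory (cr·Kc·ℓ) ρ Λ` with `ρ = θ′ + Kc·δ`,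
`Λ k i = cr·Kc·ℓ·ρ^{k−i}`.  The invariant set is no longer an input.  HYPOTHESES ONLY about an abstract scheme; NE4 for Bałaban's β is NOT proved. [folklore] -/
theorem ne4_of_gaugeBall (hθ : 0 < θ') (hN : 1 ≤ N) (hT : ‖T₀ ^ N‖ ≤ θ' ^ N)
    (hdef : LinearDefect A T₀ (gaugeBall T₀ θ' N R) δ γ) (hδ : 0 ≤ δ) (hsrc : FirstStep A 0 s γ) (hR : 0 ≤ R)
    (hbal : Kc T₀ θ' N * s + (θ' + Kc T₀ θ' N * δ) * R ≤ R)
    (hlip : StateCouplingLipschitz A (gaugeBall T₀ θ' N R) ℓ γ) (hcr : 0 ≤ cr) (hℓ : 0 ≤ ℓ)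
    (hrep : RepresentsAut A r 0 γ β) (hr : ReadLipschitzOn r (gaugeBall T₀ θ' N R) cr) :
    ScaleShiftRate (cr * Kc T₀ θ' N * s * (θ' + Kc T₀ θ' N * δ)) (θ' + Kc T₀ θ' N * δ) γ β ∧
    HistLipschitz (fun k i => cr * Kc T₀ θ' N * ℓ * (θ' + Kc T₀ θ' N * δ) ^ (k - i)) γ β ∧
    FadingMemory (cr * Kc T₀ θ' N * ℓ) (θ' + Kc T₀ θ' N * δ)
      (fun k i => cr * Kc T₀ θ' N * ℓ * (θ' + Kc T₀ θ' N * δ) ^ (k - i)) :=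
  have hInv := invariant_gaugeBall hθ hN hT hdef hδ hsrc hR hbal
  ne4_of_linearDefect hθ hN hT hInv (zero_mem_gaugeBall T₀ θ' N hR) hdef hδ hlip hsrc hcr hℓ hrep hr

/-- **THE β⁰-HALF (AF-0r) FROM THE SAME CLOSED LIST** (census (R31)'s `conv_of_scaleShiftRate` after `ne4_of_gaugeBall`): with the printed one-loop split
`Sp` of `β` and the corner bound `|β¹_{k+1}(p)| ≤ C₁·g_k` (shape (AF-1)), and the rate `ρ = θ′ + Kc·δ < 1` (defect small against the gap):
`∃ β⁰_∞, |β⁰_{k+1} − β⁰_∞| ≤ (cr·Kc·s·ρ ∕ (1 − ρ))·ρ^k`.  The identification of `β⁰_∞` (row an3) is untouched; bookkeeping over UNPRINTED inputs. [folklore] -/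
theorem conv_of_gaugeBall (Sp : B12Beta.OneLoopSplit β) {C₁ : ℝ} (hγ : 0 < γ) (hθ : 0 < θ') (hN : 1 ≤ N) (hT : ‖T₀ ^ N‖ ≤ θ' ^ N)
    (hdef : LinearDefect A T₀ (gaugeBall T₀ θ' N R) δ γ) (hδ : 0 ≤ δ) (hsrc : FirstStep A 0 s γ) (hR : 0 ≤ R)
    (hbal : Kc T₀ θ' N * s + (θ' + Kc T₀ θ' N * δ) * R ≤ R) (hgap : θ' + Kc T₀ θ' N * δ < 1) (hcr : 0 ≤ cr)
    (hrep : RepresentsAut A r 0 γ β) (hr : ReadLipschitzOn r (gaugeBall T₀ θ' N R) cr)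
    (hC : ∀ k (p : Fin (k + 1) → ℝ), p ∈ Box γ k → |Sp.β1 k p| ≤ C₁ * p (Fin.last k)) :
    ∃ binf : ℝ, ∀ k, |Sp.β0 k - binf| ≤
      cr * Kc T₀ θ' N * s * (θ' + Kc T₀ θ' N * δ) / (1 - (θ' + Kc T₀ θ' N * δ)) * (θ' + Kc T₀ θ' N * δ) ^ k :=
  have hInv := invariant_gaugeBall hθ hN hT hdef hδ hsrc hR hbal
  conv_of_scaleShiftRate Sp hγ hgap hC
    (scaleShiftRate_of_linearDefect hθ hN hT hInv (zero_mem_gaugeBall T₀ θ' N hR) hdef hδ hsrc hcr hrep hr)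

end Closed

/-! ## §4 The spectral form: for every rate above the spectral radius of the ONE linearised operator there is a defect threshold (qualitative: Gelfand) -/

section Spectral

variable {E : Type*} [NormedAddCommGroup E] [NormedSpace ℂ E] [CompleteSpace E]

/-- **STABILITY BY FIRST APPROXIMATION, SPECTRAL FORM.**  Let `T` be a bounded operator on a complex Banach space with `spectralRadius ℂ T < θ′`, and
`θ′ < θ″`.  Then there are a constant `K ≥ 1` and a threshold `δ₀ > 0` such that EVERY real scheme `A` on `E` with an invariant set `S` and a
linearization defect `δ ≤ δ₀` relative to `T` on `S` is uniformly exponentially stable along admissible orbits at rate `θ″` with constant `K`: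
`OrbitStability A S K θ″ γ`.  On the AUTONOMOUS road a SPECTRAL hypothesis on ONE operator therefore suffices — in contrast with the non-autonomous
flag road, where `T4SpectralRenewal.hazard_not_cocycleBound` exhibits steps of spectral radius `0` whose cocycle grows like `4^m`.  The constants are
NOT explicit (Gelfand's formula): `K = max (Kc T θ′ N) 1`, `δ₀ = (θ″ − θ′)∕K` for the non-constructive depth `N` of §1. [folklore] -/
theorem orbitStability_of_spectralRadius (T : E →L[ℂ] E) {θ' θ'' : ℝ} (hθ : 0 < θ')
    (h : spectralRadius ℂ T < ENNReal.ofReal θ') (hθ'' : θ' < θ'') :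
    ∃ K δ₀ : ℝ, 1 ≤ K ∧ 0 < δ₀ ∧ ∀ (A : ℝ → E → E) (S : Set E) (δ γ : ℝ), 0 ≤ δ → δ ≤ δ₀ →
      Invariant A S γ → LinearDefect A (T.restrictScalars ℝ) S δ γ → OrbitStability A S K θ'' γ := by
  obtain ⟨N, hN, hT⟩ := exists_pow_norm_restrictScalars_le T hθ.le h
  have hKc : 0 ≤ Kc (T.restrictScalars ℝ) θ' N := Kc_nonneg _ hθ.le N
  set K := max (Kc (T.restrictScalars ℝ) θ' N) 1 with hK
  have hK1 : 1 ≤ K := le_max_right _ _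
  have hKcK : Kc (T.restrictScalars ℝ) θ' N ≤ K := le_max_left _ _
  have hK0 : 0 < K := lt_of_lt_of_le one_pos hK1
  refine ⟨K, (θ'' - θ') / K, hK1, div_pos (sub_pos.mpr hθ'') hK0, ?_⟩
  intro A S δ γ hδ hδ₀ hInv hdef
  have hst := orbitStability_of_linearDefect hθ hN hT hInv hdef hδ
  refine hst.mono hKcK (by positivity) ?_ hK0.le
  have h1 : K * δ ≤ θ'' - θ' := by
    calc K * δ ≤ K * ((θ'' - θ') / K) := mul_le_mul_of_nonneg_left hδ₀ hK0.le
      _ = θ'' - θ' := mul_div_cancel₀ _ hK0.ne'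
  have h2 : Kc (T.restrictScalars ℝ) θ' N * δ ≤ K * δ := mul_le_mul_of_nonneg_right hKcK hδ
  linarith

/-- **NE4 AT EVERY RATE ABOVE THE SPECTRAL RADIUS OF THE LINEARISATION** (spectral form of (R43)'s `scaleShiftRate_of_linearDefect`): with
`spectralRadius ℂ T < θ′ < θ″` there are `K ≥ 1`, `δ₀ > 0` such that every real scheme with invariant set `S ∋ ξ`, defect `δ ≤ δ₀` relative to `T` on `S`,
first-step displacement `D` and a `cr`-Lipschitz read-out representing `β` has `ScaleShiftRate (cr·K·D·θ″) θ″ γ β`.  «NE4's rate is any number above the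
leading irrelevant eigenvalue» — as a hypothesis shape on ONE operator; nothing of Bałaban's is asserted. [folklore] -/
theorem scaleShiftRate_of_spectralRadius (T : E →L[ℂ] E) {θ' θ'' : ℝ} (hθ : 0 < θ')
    (h : spectralRadius ℂ T < ENNReal.ofReal θ') (hθ'' : θ' < θ'') :
    ∃ K δ₀ : ℝ, 1 ≤ K ∧ 0 < δ₀ ∧ ∀ (A : ℝ → E → E) (S : Set E) (ξ : E) (r : E → ℝ) (β : HBeta) (δ D γ cr : ℝ),
      0 ≤ δ → δ ≤ δ₀ → 0 ≤ cr → Invariant A S γ → ξ ∈ S → LinearDefect A (T.restrictScalars ℝ) S δ γ →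
      FirstStep A ξ D γ → RepresentsAut A r ξ γ β → ReadLipschitzOn r S cr →
      ScaleShiftRate (cr * K * D * θ'') θ'' γ β := by
  obtain ⟨K, δ₀, hK1, hδ₀, hst⟩ := orbitStability_of_spectralRadius T hθ h hθ''
  refine ⟨K, δ₀, hK1, hδ₀, ?_⟩
  intro A S ξ r β δ D γ cr hδ hδle hcr hInv hξ hdef hfirst hrep hr
  exact scaleShiftRate_of_stable hInv hξ (hst A S δ γ hδ hδle hInv hdef) hfirst (le_trans zero_le_one hK1)
    (le_of_lt (hθ.trans hθ'')) hcr hrep hr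

/-- **NODE U2's β-SIDE TRIPLE IN THE SPECTRAL FORM**: the same data plus coupling-Lipschitz `ℓ` on `S` give `ScaleShiftRate ∧ HistLipschitz ∧ FadingMemory` at the
ONE rate `θ″`, constants `× K` (`ne4_of_stable` after `orbitStability_of_spectralRadius`).  HYPOTHESES ONLY. [folklore] -/
theorem ne4_of_spectralRadius (T : E →L[ℂ] E) {θ' θ'' : ℝ} (hθ : 0 < θ')
    (h : spectralRadius ℂ T < ENNReal.ofReal θ') (hθ'' : θ' < θ'') :
    ∃ K δ₀ : ℝ, 1 ≤ K ∧ 0 < δ₀ ∧ ∀ (A : ℝ → E → E) (S : Set E) (ξ : E) (r : E → ℝ) (β : HBeta) (δ D ℓ γ cr : ℝ),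
      0 ≤ δ → δ ≤ δ₀ → 0 ≤ cr → 0 ≤ ℓ → Invariant A S γ → ξ ∈ S → LinearDefect A (T.restrictScalars ℝ) S δ γ →
      StateCouplingLipschitz A S ℓ γ → FirstStep A ξ D γ → RepresentsAut A r ξ γ β → ReadLipschitzOn r S cr →
      ScaleShiftRate (cr * K * D * θ'') θ'' γ β ∧
      HistLipschitz (fun k i => cr * K * ℓ * θ'' ^ (k - i)) γ β ∧
      FadingMemory (cr * K * ℓ) θ'' (fun k i => cr * K * ℓ * θ'' ^ (k - i)) := by
  obtain ⟨K, δ₀, hK1, hδ₀, hst⟩ := orbitStability_of_spectralRadius T hθ h hθ''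
  refine ⟨K, δ₀, hK1, hδ₀, ?_⟩
  intro A S ξ r β δ D ℓ γ cr hδ hδle hcr hℓ hInv hξ hdef hlip hfirst hrep hr
  exact ne4_of_stable hInv hξ (hst A S δ γ hδ hδle hInv hdef) hlip hfirst (le_trans zero_le_one hK1)
    (le_of_lt (hθ.trans hθ'')) hcr hℓ hrep hr

end Spectral

/-! ## §5 Exactness of the spectral form: no rate below the spectral radius of the linearisation, even with zero defect -/

section Exactness

variable {A : Type*} [NormedRing A] [NormedAlgebra ℂ A] [CompleteSpace A]

/-- **A POWER BOUND FORCES THE SPECTRAL RADIUS BELOW ITS RATE** (the converse direction of Gelfand's formula, in any complex Banach algebra):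
`T4SpectralRenewal.PowerBound C θ a` (`‖aⁿ‖ ≤ Cθⁿ`, `θ ≥ 0`) ⟹ `spectralRadius ℂ a ≤ θ`.  (`ρ(a) ≤ ‖aⁿ‖^{1∕n}·‖1‖^{1∕n}`, Mathlib
`spectrum.spectralRadius_le_pow_nnnorm_pow_one_div`, and `(C‖1‖)^{1∕n} → 1`, Mathlib `ENNReal.eventually_pow_one_div_le`.) [folklore] -/
theorem spectralRadius_le_of_powerBound {a : A} {C θ : ℝ} (hθ : 0 ≤ θ) (h : PowerBound C θ a) :
    spectralRadius ℂ a ≤ ENNReal.ofReal θ := by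
  have hC : 0 ≤ C := (norm_nonneg (1 : A)).trans (by simpa using h 0)
  have eθ : ENNReal.ofReal θ = ((θ.toNNReal : ℝ≥0) : ℝ≥0∞) := rfl
  set c : ℝ≥0∞ := ((C.toNNReal * ‖(1 : A)‖₊ : ℝ≥0) : ℝ≥0∞) with hc
  have stepA : ∀ n : ℕ, spectralRadius ℂ a ≤ c ^ (((n + 1 : ℕ) : ℝ)⁻¹) * ENNReal.ofReal θ := fun n => by
    have hpos : (0 : ℝ) ≤ ((n + 1 : ℕ) : ℝ)⁻¹ := by positivity
    have e1 : (1 / ((n : ℝ) + 1)) = ((n + 1 : ℕ) : ℝ)⁻¹ := by rw [one_div, Nat.cast_succ]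
    have h1 := spectrum.spectralRadius_le_pow_nnnorm_pow_one_div ℂ a n
    rw [e1] at h1
    have h2 : (‖a ^ (n + 1)‖₊ : ℝ≥0∞) ≤ (C.toNNReal : ℝ≥0∞) * (θ.toNNReal : ℝ≥0∞) ^ (n + 1) := by
      have e : (‖a ^ (n + 1)‖₊ : ℝ≥0) ≤ C.toNNReal * θ.toNNReal ^ (n + 1) := by
        rw [← NNReal.coe_le_coe, NNReal.coe_mul, NNReal.coe_pow, Real.coe_toNNReal _ hC, Real.coe_toNNReal _ hθ,
          coe_nnnorm]
        exact h (n + 1)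
      exact_mod_cast e
    have h3 : (‖a ^ (n + 1)‖₊ : ℝ≥0∞) ^ (((n + 1 : ℕ) : ℝ)⁻¹)
        ≤ (C.toNNReal : ℝ≥0∞) ^ (((n + 1 : ℕ) : ℝ)⁻¹) * (θ.toNNReal : ℝ≥0∞) := by
      calc (‖a ^ (n + 1)‖₊ : ℝ≥0∞) ^ (((n + 1 : ℕ) : ℝ)⁻¹)
          ≤ ((C.toNNReal : ℝ≥0∞) * (θ.toNNReal : ℝ≥0∞) ^ (n + 1)) ^ (((n + 1 : ℕ) : ℝ)⁻¹) := ENNReal.rpow_le_rpow h2 hpos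
        _ = (C.toNNReal : ℝ≥0∞) ^ (((n + 1 : ℕ) : ℝ)⁻¹) * (θ.toNNReal : ℝ≥0∞) := by
            rw [ENNReal.mul_rpow_of_nonneg _ _ hpos, ENNReal.pow_rpow_inv_natCast (Nat.succ_ne_zero n)]
    calc spectralRadius ℂ a
        ≤ (‖a ^ (n + 1)‖₊ : ℝ≥0∞) ^ (((n + 1 : ℕ) : ℝ)⁻¹) * (‖(1 : A)‖₊ : ℝ≥0∞) ^ (((n + 1 : ℕ) : ℝ)⁻¹) := h1
      _ ≤ ((C.toNNReal : ℝ≥0∞) ^ (((n + 1 : ℕ) : ℝ)⁻¹) * (θ.toNNReal : ℝ≥0∞)) * (‖(1 : A)‖₊ : ℝ≥0∞) ^ (((n + 1 : ℕ) : ℝ)⁻¹) := by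
          gcongr
      _ = c ^ (((n + 1 : ℕ) : ℝ)⁻¹) * ENNReal.ofReal θ := by
          rw [hc, ENNReal.coe_mul, ENNReal.mul_rpow_of_nonneg _ _ hpos, eθ]; ring
  refine ENNReal.le_of_forall_lt_one_mul_le fun ε hε => ?_
  rcases eq_or_ne ε 0 with rfl | hε0
  · simp
  have hε_top : ε ≠ ∞ := ne_top_of_lt hε
  obtain ⟨M, hM⟩ := Filter.eventually_atTop.1
    (ENNReal.eventually_pow_one_div_le (ENNReal.coe_ne_top : c ≠ ∞) (ENNReal.one_lt_inv.2 hε))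
  have hm : c ^ (((M + 1 : ℕ) : ℝ)⁻¹) ≤ ε⁻¹ := by
    have := hM (M + 1) (Nat.le_succ M)
    rwa [one_div] at this
  calc ε * spectralRadius ℂ a ≤ ε * (c ^ (((M + 1 : ℕ) : ℝ)⁻¹) * ENNReal.ofReal θ) := by gcongr; exact stepA M
    _ ≤ ε * (ε⁻¹ * ENNReal.ofReal θ) := by gcongr
    _ = ENNReal.ofReal θ := by rw [← mul_assoc, ENNReal.mul_inv_cancel hε0 hε_top, one_mul]

/-- **THE LINEAR SCHEME's ORBIT STABILITY IS A POWER BOUND**: for the purely linear autonomous scheme `A g x = T x` on a real normed space (defect `0`,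
bare state `0`), `OrbitStability A univ C θ γ` (`γ > 0`, `C, θ ≥ 0`) ⟹ `PowerBound C θ T` (composites along any admissible sequence are the powers
`Tⁿ`). [folklore] -/
theorem powerBound_of_orbitStability_linear {E : Type*} [NormedAddCommGroup E] [NormedSpace ℝ E] (T : E →L[ℝ] E) {C θ γ : ℝ}
    (hγ : 0 < γ) (hC : 0 ≤ C) (hθ : 0 ≤ θ) (h : OrbitStability (fun (_ : ℝ) (x : E) => T x) Set.univ C θ γ) :
    PowerBound C θ T := by
  have hiter : ∀ n (x : E), iter (fun (_ : ℝ) (x : E) => T x) (fun _ => γ) 0 n x = (T ^ n) x := fun n => by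
    induction n with
    | zero => intro x; simp
    | succ n ih => intro x; rw [iter_succ, ih, pow_succ']; rfl
  intro n
  refine ContinuousLinearMap.opNorm_le_bound _ (by positivity) fun x => ?_
  have hx := h (fun _ => γ) (fun _ => ⟨hγ, le_rfl⟩) 0 n x (Set.mem_univ _) 0 (Set.mem_univ _)
  rwa [hiter, hiter, map_zero, dist_zero_right, dist_zero_right] at hx

/-- **EXACTNESS OF THE SPECTRAL FORM — NO RATE BELOW THE SPECTRAL RADIUS, EVEN WITH ZERO DEFECT.**  For a bounded operator `T` on a complex
Banach space, if the linear scheme `x ↦ T x` is uniformly exponentially stable along orbits at rate `θ` (any constant `C ≥ 0`, on all of `E`), then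
`spectralRadius ℂ T ≤ θ`.  With §4: on the autonomous road the achievable NE4 rates of the linearised scheme are EXACTLY the numbers above the spectral
radius of the ONE linearised operator (every `θ″ > ρ(T)` by `orbitStability_of_spectralRadius`, none below by this theorem) — «rate = leading irrelevant
eigenvalue» as a two-sided kernel statement about hypothesis shapes; nothing of Bałaban's is asserted. [folklore] -/
theorem spectralRadius_le_of_orbitStability_linear {E : Type*} [NormedAddCommGroup E] [NormedSpace ℂ E] [CompleteSpace E]
    (T : E →L[ℂ] E) {C θ γ : ℝ} (hγ : 0 < γ) (hC : 0 ≤ C) (hθ : 0 ≤ θ)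
    (h : OrbitStability (fun (_ : ℝ) (x : E) => T x) Set.univ C θ γ) : spectralRadius ℂ T ≤ ENNReal.ofReal θ := by
  have hP : PowerBound C θ (T.restrictScalars ℝ) := powerBound_of_orbitStability_linear (T.restrictScalars ℝ) hγ hC hθ h
  have hP' : PowerBound C θ T := fun n => by rw [← norm_restrictScalars_pow]; exact hP n
  exact spectralRadius_le_of_powerBound hθ hP'

end Exactness

end Markov

end Summit.QuantumFields.BalabanUV.T4Continuum.Spine.NE4
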